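import Summits.AtomisticToContinuum.HydrodynamicLimit.Theses.OneFlightGossipEngine

/-!
# Sketch — crux-ideate `EnergyCurrentTails` (stmt-AtomisticToContinuum-9235), round 1, ideator 2

First lemmas of the three idea cards of this seat (planner-cruxidea-stmt-AtomisticToContinuum-9235-2-0):

* card `quartic-disparity-closure`  — §A (normal-swap and the EXACT pointwise quartic bracket of an
  elastic hard-sphere reflection), §B (Chebyshev transfer cubic-tail ≤ quartic / M), §C
  (`QuarticMomentBound`, the transfer target C⁺, and the PROVED implication
  `QuarticMomentBound → EnergyCurrentTails`), §D (the flux-averaged loss constant 1/3);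
* card `rim-fresh-retention-ladder` — §A (`retention_at_rest`: a sphere hitting a resting one keeps
  exactly the fraction `1 - ⟪v̂,n⟫² = b²/d²` of its energy), §E (`RimFreshnessFast`, the one-sided
  thin-set version of the route's B1′ for fast spheres, typed in the frame of
  `OneFlightLayeredChaos`; `KFreshContraction`, the bathtub bound that makes `E^α` a
  supermartingale);
* card `fresh-directions-cannot-aim` — §E (`DirFreshnessFast`, one-sided freshness of the outgoing
  direction of fast spheres, multiplicative form), §F (`fast_count_le_energy_div`: in any finite family the
  number of spheres faster than `L` is at most (kinetic energy)/L² — the deterministic step that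
  turns "fast–fast affinity" into "token-crowded cell"; `CrowdedCellsExtensive`, the extensive-cost
  statement the entropy inequality consumes).

Everything in §A, §B, §C (incl. the implication), §D, §F(first lemma) is PROVED; the typed inputs
of §E/§F are `def … : Prop` (statements only, asserted nowhere).
-/

noncomputable section

open MeasureTheory Set Filter
open scoped ENNReal InnerProductSpace BigOperators

namespace Summit.AtomisticToContinuum.HydrodynamicLimit.Cruxes.EnergyCurrentTails.IdeatorTwo

open Literature.Analysis.FluidPDE Literature.MathematicalPhysics.KineticTheory

/-! ## §A  Kinematics of one elastic reflection (any real inner product space) -/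

section Kinematics

variable {E : Type*} [NormedAddCommGroup E] [InnerProductSpace ℝ E]

/-- **Normal swap.** For a unit impact direction `n`, the first outgoing sphere keeps its tangential
kinetic energy and receives the partner's normal kinetic energy:
`‖v'‖² = ‖v‖² - ⟪v,n⟫² + ⟪w,n⟫²`. -/
theorem norm_sq_reflectVel_fst_unit (n v w : E) (hn : ‖n‖ = 1) :
    ‖(reflectVel n (v, w)).1‖ ^ 2 = ‖v‖ ^ 2 - ⟪v, n⟫_ℝ ^ 2 + ⟪w, n⟫_ℝ ^ 2 := by
  have h1 : (reflectVel n (v, w)).1 = v - (⟪v - w, n⟫_ℝ) • n := by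
    simp [reflectVel, hn]
  rw [h1, norm_sub_sq_real, real_inner_smul_right, norm_smul, Real.norm_eq_abs, hn, mul_one,
    sq_abs, inner_sub_left]
  ring

/-- The partner's energy: `‖w'‖² = ‖w‖² + ⟪v,n⟫² - ⟪w,n⟫²` (energy conservation + normal swap). -/
theorem norm_sq_reflectVel_snd_unit (n v w : E) (hn : ‖n‖ = 1) :
    ‖(reflectVel n (v, w)).2‖ ^ 2 = ‖w‖ ^ 2 + ⟪v, n⟫_ℝ ^ 2 - ⟪w, n⟫_ℝ ^ 2 := by
  have h := norm_sq_reflectVel_fst_add_norm_sq_reflectVel_snd n (v, w)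
  have h1 := norm_sq_reflectVel_fst_unit n v w hn
  simp only at h
  linarith

/-- **Retention at rest.** A sphere of velocity `v` hitting a RESTING sphere with unit contact normal
`n` keeps exactly the fraction `sin²∠(v,n) = b²/d²` of its kinetic energy:
`‖v'‖² = ‖v‖² - ⟪v,n⟫²` (first lemma of card `rim-fresh-retention-ladder`). -/
theorem retention_at_rest (n v : E) (hn : ‖n‖ = 1) :
    ‖(reflectVel n (v, 0)).1‖ ^ 2 = ‖v‖ ^ 2 - ⟪v, n⟫_ℝ ^ 2 := by
  have h := norm_sq_reflectVel_fst_unit n v 0 hn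
  simpa using h

/-- **Exact pointwise quartic bracket.** With `a = ⟪v,n⟫`, `b = ⟪w,n⟫` and unit `n`:
`‖v'‖⁴ + ‖w'‖⁴ - ‖v‖⁴ - ‖w‖⁴ = -2 (a² - b²) ((‖v‖² - a²) - (‖w‖² - b²))`
= −2 × (normal-energy disparity) × (tangential-energy disparity). For a resting partner this is
`-2 a² (‖v‖² - a²) ≤ 0` for EVERY `n`; averaged over the flux-uniform impact law (`a²/‖v‖²`
uniform on `[0,1]`, §D) it is `-‖v‖⁴/3`. (first lemma of card `quartic-disparity-closure`) -/
theorem quartic_bracket_pointwise (n v w : E) (hn : ‖n‖ = 1) :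
    (‖(reflectVel n (v, w)).1‖ ^ 2) ^ 2 + (‖(reflectVel n (v, w)).2‖ ^ 2) ^ 2
      - (‖v‖ ^ 2) ^ 2 - (‖w‖ ^ 2) ^ 2
      = -2 * (⟪v, n⟫_ℝ ^ 2 - ⟪w, n⟫_ℝ ^ 2)
          * ((‖v‖ ^ 2 - ⟪v, n⟫_ℝ ^ 2) - (‖w‖ ^ 2 - ⟪w, n⟫_ℝ ^ 2)) := by
  rw [norm_sq_reflectVel_fst_unit n v w hn, norm_sq_reflectVel_snd_unit n v w hn]
  ring

/-- Resting partner: the quartic bracket is non-positive for EVERY impact direction. -/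
theorem quartic_bracket_at_rest_nonpos (n v : E) (hn : ‖n‖ = 1) :
    (‖(reflectVel n (v, (0 : E))).1‖ ^ 2) ^ 2 + (‖(reflectVel n (v, (0 : E))).2‖ ^ 2) ^ 2
      - (‖v‖ ^ 2) ^ 2 ≤ 0 := by
  have h := quartic_bracket_pointwise n v 0 hn
  simp only [inner_zero_left, norm_zero, ne_eq, OfNat.ofNat_ne_zero, not_false_eq_true,
    zero_pow, sub_zero] at h
  have ha : ⟪v, n⟫_ℝ ^ 2 ≤ ‖v‖ ^ 2 := by
    have := abs_real_inner_le_norm v n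
    rw [hn, mul_one] at this
    nlinarith [abs_nonneg ⟪v, n⟫_ℝ, sq_abs ⟪v, n⟫_ℝ]
  nlinarith [sq_nonneg ⟪v, n⟫_ℝ]

end Kinematics

/-! ## §B  Chebyshev transfer: the cubic tail above `M` is at most quartic / `M` -/

section Transfer

variable {ι : Type*} (s : Finset ι) {E : Type*} [NormedAddCommGroup E]

/-- Termwise: `𝟙{M < ‖v‖} ‖v‖³ ≤ ‖v‖⁴ / M` for `M > 0`. -/
theorem indicator_cubic_le_quartic_div {M : ℝ} (hM : 0 < M) (v : E) :
    Set.indicator {x : E | M < ‖x‖} (fun x => ‖x‖ ^ 3) v ≤ M⁻¹ * ‖v‖ ^ 4 := by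
  by_cases hv : v ∈ {x : E | M < ‖x‖}
  · rw [Set.indicator_of_mem hv]
    have hv' : M < ‖v‖ := hv
    have hvpos : 0 < ‖v‖ := hM.trans hv'
    rw [le_inv_mul_iff₀ hM]
    calc M * ‖v‖ ^ 3 ≤ ‖v‖ * ‖v‖ ^ 3 := by gcongr
      _ = ‖v‖ ^ 4 := by ring
  · rw [Set.indicator_of_notMem hv]
    positivity

/-- **Transfer lemma** (finite sums): `Σᵢ 𝟙{M < ‖vᵢ‖} ‖vᵢ‖³ ≤ M⁻¹ Σᵢ ‖vᵢ‖⁴`. -/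
theorem cubic_tail_le_quartic {M : ℝ} (hM : 0 < M) (v : ι → E) :
    (∑ i ∈ s, Set.indicator {x : E | M < ‖x‖} (fun x => ‖x‖ ^ 3) (v i))
      ≤ M⁻¹ * ∑ i ∈ s, ‖v i‖ ^ 4 := by
  rw [Finset.mul_sum]
  exact Finset.sum_le_sum fun i _ => indicator_cubic_le_quartic_div hM (v i)

end Transfer

/-! ## §C  The transfer target C⁺ = `QuarticMomentBound` and `C⁺ → EnergyCurrentTails` (proved) -/

/-- **C⁺ (transfer target of card `quartic-disparity-closure`).** Same frame as the crux
`OneFlightGossipEngine.EnergyCurrentTails`; conclusion: the expected empirical QUARTIC velocity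
moment along the true flow is bounded, uniformly in `N ≥ N₀` and `s ≤ t < T`:
`E_{λ^N}[(N+1)⁻¹ Σᵢ ‖vᵢ(s)‖⁴] ≤ C(t, σ, profiles)`. Equilibrium value `15 θ²`; the card's engine is
a maximum principle for this one scalar driven by the exact bracket of §A. -/
def QuarticMomentBound : Prop :=
  ∀ (a₀ θ₀ : T3 → ℝ) (u₀ : T3 → V3), Continuous a₀ → Continuous θ₀ → Continuous u₀ →
    (∀ x, 0 < a₀ x) → (∀ x, 0 < θ₀ x) → ∃ σ₀ : ℝ, 0 < σ₀ ∧ ∀ σ : ℝ, 0 < σ → σ < σ₀ →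
    ∀ (T : ℝ) (ρ θ : ℝ → T3 → ℝ) (u : ℝ → T3 → V3), IsHardSphereEulerSolution σ T ρ u θ →
    ∀ Φ : (N : ℕ) → HardSphereFlow (Torus.geometry (Fin 3)) (hsDiameter σ N) (N + 1),
    TendstoHydroFieldsAt (fun N => localGibbsLaw σ a₀ u₀ θ₀ N (Φ N)) Φ ρ u θ 0 →
    ∀ t ∈ Set.Ico 0 T, ∃ C : ℝ, ∃ N₀ : ℕ, ∀ N : ℕ, N₀ ≤ N → ∀ s ∈ Set.Icc 0 t,
      ∫⁻ z, ENNReal.ofReal (((N : ℝ) + 1)⁻¹ * ∑ i : Fin (N + 1), ‖((Φ N).flow s z i).2‖ ^ 4)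
        ∂(localGibbsLaw σ a₀ u₀ θ₀ N (Φ N)) ≤ ENNReal.ofReal C

/-- **Transfer, proved:** a uniform quartic moment bound along the true flow implies the crux
(cubic uniform integrability), with `M = |C|/ε + 1`. -/
theorem energyCurrentTails_of_quarticMomentBound (hQ : QuarticMomentBound) :
    Theses.OneFlightGossipEngine.EnergyCurrentTails := by
  intro a₀ θ₀ u₀ ha hθ hu ha0 hθ0
  obtain ⟨σ₀, hσ₀, hσ⟩ := hQ a₀ θ₀ u₀ ha hθ hu ha0 hθ0
  refine ⟨σ₀, hσ₀, fun σ hs hs' T ρ θ u hE Φ h0 t ht ε hε => ?_⟩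
  obtain ⟨C, N₀, hC⟩ := hσ σ hs hs' T ρ θ u hE Φ h0 t ht
  set M : ℝ := |C| / ε + 1 with hMdef
  have hMpos : 0 < M := by positivity
  refine ⟨M, N₀, fun N hN s hs => ?_⟩
  have hkey := hC N hN s hs
  -- pointwise Chebyshev transfer inside the integral
  have hpt : ∀ z : Config (N + 1) (Fin 3) T3,
      ENNReal.ofReal (((N : ℝ) + 1)⁻¹ * ∑ i : Fin (N + 1),
          Set.indicator {v : V3 | M < ‖v‖} (fun v => ‖v‖ ^ 3) (((Φ N).flow s z i).2))
        ≤ ENNReal.ofReal M⁻¹ *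
          ENNReal.ofReal (((N : ℝ) + 1)⁻¹ * ∑ i : Fin (N + 1), ‖((Φ N).flow s z i).2‖ ^ 4) := by
    intro z
    rw [← ENNReal.ofReal_mul (inv_nonneg.2 hMpos.le)]
    apply ENNReal.ofReal_le_ofReal
    have hN1 : (0 : ℝ) ≤ ((N : ℝ) + 1)⁻¹ := by positivity
    have h := cubic_tail_le_quartic (Finset.univ : Finset (Fin (N + 1))) hMpos
      (fun i => ((Φ N).flow s z i).2)
    calc ((N : ℝ) + 1)⁻¹ * ∑ i : Fin (N + 1),
            Set.indicator {v : V3 | M < ‖v‖} (fun v => ‖v‖ ^ 3) (((Φ N).flow s z i).2)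
          ≤ ((N : ℝ) + 1)⁻¹ * (M⁻¹ * ∑ i : Fin (N + 1), ‖((Φ N).flow s z i).2‖ ^ 4) :=
            mul_le_mul_of_nonneg_left h hN1
      _ = M⁻¹ * (((N : ℝ) + 1)⁻¹ * ∑ i : Fin (N + 1), ‖((Φ N).flow s z i).2‖ ^ 4) := by ring
  calc ∫⁻ z, ENNReal.ofReal (((N : ℝ) + 1)⁻¹ * ∑ i : Fin (N + 1),
          Set.indicator {v : V3 | M < ‖v‖} (fun v => ‖v‖ ^ 3) (((Φ N).flow s z i).2))
          ∂(localGibbsLaw σ a₀ u₀ θ₀ N (Φ N))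
        ≤ ∫⁻ z, ENNReal.ofReal M⁻¹ *
          ENNReal.ofReal (((N : ℝ) + 1)⁻¹ * ∑ i : Fin (N + 1), ‖((Φ N).flow s z i).2‖ ^ 4)
          ∂(localGibbsLaw σ a₀ u₀ θ₀ N (Φ N)) := lintegral_mono hpt
    _ = ENNReal.ofReal M⁻¹ * ∫⁻ z,
          ENNReal.ofReal (((N : ℝ) + 1)⁻¹ * ∑ i : Fin (N + 1), ‖((Φ N).flow s z i).2‖ ^ 4)
          ∂(localGibbsLaw σ a₀ u₀ θ₀ N (Φ N)) :=
          lintegral_const_mul' _ _ ENNReal.ofReal_ne_top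
    _ ≤ ENNReal.ofReal M⁻¹ * ENNReal.ofReal C := by gcongr
    _ = ENNReal.ofReal (M⁻¹ * C) := (ENNReal.ofReal_mul (inv_nonneg.2 hMpos.le)).symm
    _ ≤ ENNReal.ofReal ε := by
          apply ENNReal.ofReal_le_ofReal
          have h1 : M⁻¹ * C ≤ M⁻¹ * |C| :=
            mul_le_mul_of_nonneg_left (le_abs_self C) (inv_nonneg.2 hMpos.le)
          have h2 : M⁻¹ * |C| ≤ ε := by
            rw [inv_mul_le_iff₀ hMpos, hMdef]
            have : |C| = (|C| / ε) * ε := by field_simp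
            nlinarith [abs_nonneg C, hε.le]
          exact h1.trans h2

/-! ## §D  The flux-averaged loss constant -/

/-- Under the flux-uniform impact law the retained fraction `u = sin²ψ` (equivalently `cos²ψ`) is
uniform on `[0,1]`; the mean fractional quartic loss of a fast sphere on a resting one is
`∫₀¹ 2u(1-u) du = 1/3` (the `-‖v‖⁴/3` of the card), and the mean retained energy is `1/2`. -/
theorem flux_average_quartic_loss : ∫ u in (0 : ℝ)..1, 2 * u * (1 - u) = 1 / 3 := by
  have : (fun u : ℝ => 2 * u * (1 - u)) = fun u => 2 * u ^ 1 - 2 * u ^ 2 := by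
    funext u; ring
  rw [this, intervalIntegral.integral_sub, intervalIntegral.integral_const_mul,
    intervalIntegral.integral_const_mul, integral_pow, integral_pow]
  · norm_num
  · exact (continuous_const.mul (continuous_pow 1)).intervalIntegrable _ _
  · exact (continuous_const.mul (continuous_pow 2)).intervalIntegrable _ _

theorem flux_average_retention : ∫ u in (0 : ℝ)..1, u = 1 / 2 := by
  simp [integral_id]

/-! ## §E  Inputs of card `rim-fresh-retention-ladder` (typed statements, asserted nowhere) -/

/-- **K-fresh contraction (bathtub form).** If the retained fraction `u ∈ [0,1]` of a fast sphere's
energy has a conditional law with density at most `K` w.r.t. Lebesgue on `[0,1]` (one-sided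
freshness of the impact parameter), then for every `α > 0` its `α`-moment is at most
`γ(α,K) := K/(α+1) · (1 - (1 - 1/K)^(α+1)) < 1` — the worst case piles all mass next to `u = 1`.
Consequence: `E^α` of a fast sphere is a strict supermartingale along its own collisions with
resting partners, for EVERY `α`. (Real-analysis lemma; statement only.) -/
def KFreshContraction : Prop :=
  ∀ (K α : ℝ), 1 ≤ K → 0 < α → ∀ ρ : ℝ → ℝ, Measurable ρ → (∀ u, 0 ≤ ρ u) → (∀ u, ρ u ≤ K) →
    ∫ u in (0 : ℝ)..1, ρ u = 1 →
    ∫ u in (0 : ℝ)..1, u ^ α * ρ u ≤ K / (α + 1) * (1 - (1 - 1 / K) ^ (α + 1))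

/-- **RimFreshnessFast — one-sided thin-set freshness of the impact geometry for FAST spheres
along the TRUE flow** (the only impact statistic of card `rim-fresh-retention-ladder`; a
one-sided, fast-sphere restriction of the route's `OneFlightLayeredChaos`, but under the LOCAL
Gibbs law of the crux, UNIFORM in the collision index `n` (a macroscopic time horizon `t` carries
`≍ (N+1)^{1/3}` collisions per sphere) and with MULTIPLICATIVE slack — an additive `C σ^p` would be
vacuous for rare fast spheres). Frame of the crux up to the flow family; then: there are
`K, C, p, ρ, L₀` such that for every horizon `t`, level `L ≥ L₀`, rim width `η ∈ (0,1)`,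
eventually in `N`, for every particle `i`, collision index `n` and every event `E` of the coarse
past of that collision (cells of side `ρ (N+1)^{-1/3}` of ALL positions at the two flight starts,
exact velocities, partner identity — the σ-algebra of `OneFlightLayeredChaos`):
`P(W ∩ Fast ∩ Rim_η ∩ E) ≤ (K η + C σ^p) · P(W ∩ Fast ∩ E)`, where `W = {i has ≥ n+1 collisions in
(0, t]}` (no junk records), `Fast = {‖v_i⁻‖ ≥ L}` (pre-collisional speed of `i`), and
`Rim_η = {⟪v_i⁻ - v_j⁻, ω⟫² ≤ η ‖v_i⁻ - v_j⁻‖²}` (grazing: impact parameter in the outer rim of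
relative area `η`; probability exactly `η` under the flux-uniform law). The slack `C σ^p` allows a
conditional atom at exact grazing (e.g. an aligned relay) of conditional mass `O(σ^p)`. -/
def RimFreshnessFast : Prop :=
  ∀ (a₀ θ₀ : T3 → ℝ) (u₀ : T3 → V3), Continuous a₀ → Continuous θ₀ → Continuous u₀ →
    (∀ x, 0 < a₀ x) → (∀ x, 0 < θ₀ x) → ∃ σ₀ : ℝ, 0 < σ₀ ∧ ∀ σ : ℝ, 0 < σ → σ < σ₀ →
    ∃ K : ℝ, 0 < K ∧ ∃ C : ℝ, 0 < C ∧ ∃ p : ℝ, 0 < p ∧ ∃ ρ : ℝ, σ ≤ ρ ∧ ∃ L₀ : ℝ, 0 < L₀ ∧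
    ∀ Φ : (N : ℕ) → HardSphereFlow (Torus.geometry (Fin 3)) (hsDiameter σ N) (N + 1),
    ∀ t : ℝ, 0 < t → ∀ L : ℝ, L₀ ≤ L → ∀ η : ℝ, 0 < η → η < 1 → ∃ N₀ : ℕ, ∀ N : ℕ, N₀ ≤ N →
    ∀ (n : ℕ) (i : Fin (N + 1)),
      let G : Geometry (Fin 3) T3 := Torus.geometry (Fin 3)
      let ε : ℝ := hsDiameter σ N
      let P : Measure (Config (N + 1) (Fin 3) T3) := localGibbsLaw σ a₀ u₀ θ₀ N (Φ N)
      let q : T3 → (Fin 3 → ℤ) := Torus.coarseCell (ρ * ((N + 1 : ℕ) : ℝ) ^ (-(1 / 3 : ℝ)))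
      let c : Config (N + 1) (Fin 3) T3 → HardSphereCollisionRecord (Fin 3) T3 (N + 1) :=
        fun z => (Φ N).nthRecordOf i n z
      let W : Set (Config (N + 1) (Fin 3) T3) :=
        {z | n + 1 ≤ Set.ncard (collisionTimesOf G ε (fun r => (Φ N).flow r z) i ∩ Set.Ioc 0 t)}
      let Fast : Set (Config (N + 1) (Fin 3) T3) := {z | L ≤ ‖(c z).preVel.1‖}
      let Rim : Set (Config (N + 1) (Fin 3) T3) :=
        {z | ⟪(c z).preVel.1 - (c z).preVel.2, (c z).impactVec⟫_ℝ ^ 2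
              ≤ η * ‖(c z).preVel.1 - (c z).preVel.2‖ ^ 2}
      ∀ E : Set (Config (N + 1) (Fin 3) T3),
        MeasurableSet[MeasurableSpace.comap (fun z => ((Φ N).coarsePastOf q i n z,
          (Φ N).nthPartnerOf i n z)) inferInstance] E →
        (P (W ∩ Fast ∩ Rim ∩ E)).toReal ≤ (K * η + C * σ ^ p) * (P (W ∩ Fast ∩ E)).toReal

/-- **DirFreshnessFast — one-sided freshness of the OUTGOING DIRECTION of a fast sphere** (the
statistical input of card `fresh-directions-cannot-aim`; the multiplicative, fast-sphere cousin of
`OneFlightLayeredChaos`, whose additive TV form is too weak for the thin aiming cones of solid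
angle `≍ d_N ℓ_N / r²`). Same frame and σ-algebra as `RimFreshnessFast`; conclusion: for every
measurable `B ⊆ ℝ³`, `P(W ∩ Fast ∩ {outDir ∈ B} ∩ E) ≤ (K u(B) + C σ^p u(B)^{1/2}) P(W ∩ Fast ∩ E)`,
`u` = normalised sphere measure of `B` (the `u^{1/2}` slack lets conditional laws carry mild
singularities but no atoms; aiming cones at distance `≍ ℓ_N` have `u` between `≍ σ⁶` (`d²/ℓ²`,
slow target) and `≍ σ³` (`dℓ/ℓ²`, fast target), so `C σ^p u^{1/2} ≪ u` for all of them needs `p > 3`,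
recorded in the card as the quantitative bet). -/
def DirFreshnessFast : Prop :=
  ∀ (a₀ θ₀ : T3 → ℝ) (u₀ : T3 → V3), Continuous a₀ → Continuous θ₀ → Continuous u₀ →
    (∀ x, 0 < a₀ x) → (∀ x, 0 < θ₀ x) → ∃ σ₀ : ℝ, 0 < σ₀ ∧ ∀ σ : ℝ, 0 < σ → σ < σ₀ →
    ∃ K : ℝ, 0 < K ∧ ∃ C : ℝ, 0 < C ∧ ∃ p : ℝ, 3 < p ∧ ∃ ρ : ℝ, σ ≤ ρ ∧ ∃ L₀ : ℝ, 0 < L₀ ∧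
    ∀ Φ : (N : ℕ) → HardSphereFlow (Torus.geometry (Fin 3)) (hsDiameter σ N) (N + 1),
    ∀ t : ℝ, 0 < t → ∀ L : ℝ, L₀ ≤ L → ∃ N₀ : ℕ, ∀ N : ℕ, N₀ ≤ N →
    ∀ (n : ℕ) (i : Fin (N + 1)) (B : Set V3), MeasurableSet B →
      let G : Geometry (Fin 3) T3 := Torus.geometry (Fin 3)
      let ε : ℝ := hsDiameter σ N
      let P : Measure (Config (N + 1) (Fin 3) T3) := localGibbsLaw σ a₀ u₀ θ₀ N (Φ N)
      let q : T3 → (Fin 3 → ℤ) := Torus.coarseCell (ρ * ((N + 1 : ℕ) : ℝ) ^ (-(1 / 3 : ℝ)))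
      let c : Config (N + 1) (Fin 3) T3 → HardSphereCollisionRecord (Fin 3) T3 (N + 1) :=
        fun z => (Φ N).nthRecordOf i n z
      let W : Set (Config (N + 1) (Fin 3) T3) :=
        {z | n + 1 ≤ Set.ncard (collisionTimesOf G ε (fun r => (Φ N).flow r z) i ∩ Set.Ioc 0 t)}
      let Fast : Set (Config (N + 1) (Fin 3) T3) := {z | L ≤ ‖(c z).postVel.1‖}
      let A : Set (Config (N + 1) (Fin 3) T3) := {z | ‖(c z).postVel.1‖⁻¹ • (c z).postVel.1 ∈ B}
      let u : ℝ := (((sphereMeasure (E := V3)) Set.univ)⁻¹ *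
        (sphereMeasure (E := V3)) {ω | (ω : V3) ∈ B}).toReal
      ∀ E : Set (Config (N + 1) (Fin 3) T3),
        MeasurableSet[MeasurableSpace.comap (fun z => ((Φ N).coarsePastOf q i n z,
          (Φ N).nthPartnerOf i n z)) inferInstance] E →
        (P (W ∩ Fast ∩ A ∩ E)).toReal
          ≤ (K * u + C * σ ^ p * Real.sqrt u) * (P (W ∩ Fast ∩ E)).toReal

/-! ## §F  Inputs of card `fresh-directions-cannot-aim` -/

section Crowding

variable {ι : Type*} (s : Finset ι) {E : Type*} [NormedAddCommGroup E]

/-- **Energy–Markov inside a cell** (first lemma of card `fresh-directions-cannot-aim`): in any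
finite family, the number of spheres with speed at least `L > 0` is at most the family's kinetic
energy (here `Σ ‖v‖²`) divided by `L²`. This is the deterministic step "fast–fast affinity needs a
token-CROWDED cell": a cell in which a fraction `q` of the `n_c` spheres are faster than `L` has
energy `≥ q n_c L²`. -/
theorem fast_count_le_energy_div {L : ℝ} (hL : 0 < L) (v : ι → E) :
    ((s.filter fun i => L ≤ ‖v i‖).card : ℝ) ≤ L⁻¹ ^ 2 * ∑ i ∈ s, ‖v i‖ ^ 2 := by
  have hL2 : 0 < L ^ 2 := by positivity
  have key : ((s.filter fun i => L ≤ ‖v i‖).card : ℝ) * L ^ 2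
      ≤ ∑ i ∈ s, ‖v i‖ ^ 2 := by
    calc ((s.filter fun i => L ≤ ‖v i‖).card : ℝ) * L ^ 2
          = ∑ i ∈ s.filter (fun i => L ≤ ‖v i‖), L ^ 2 := by
            rw [Finset.sum_const, nsmul_eq_mul]
      _ ≤ ∑ i ∈ s.filter (fun i => L ≤ ‖v i‖), ‖v i‖ ^ 2 := by
            apply Finset.sum_le_sum
            intro i hi
            have hi' : L ≤ ‖v i‖ := (Finset.mem_filter.1 hi).2
            gcongr
      _ ≤ ∑ i ∈ s, ‖v i‖ ^ 2 :=
            Finset.sum_le_sum_of_subset_of_nonneg (Finset.filter_subset _ _)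
              (fun i _ _ => by positivity)
  rw [inv_pow, ← div_eq_inv_mul, le_div_iff₀ hL2]
  exact key

end Crowding

/-- **CrowdedCellsFew (the cheap half of card `fresh-directions-cannot-aim`; provable now).**
Frame of the crux; `q ∈ (0,1)` a crowding fraction, cells of side `r(N+1)^{-1/3}` (kinetic scale
for `r = 1/(√2 π σ²)`), level `L`. CLAIM: along the true flow, for all `s ≤ t < T`, the expected
FRACTION OF PARTICLES lying in `(L, q)`-crowded cells (cells in which at least a fraction `q` of
the spheres have speed `≥ L`) is at most `C/(q L²)` eventually in `N`. PROOF ROUTE (no entropy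
needed): a crowded cell `c` has `n_c ≤ q⁻¹ #{fast in c}`, so the particles in crowded cells number
at most `q⁻¹ #{i : ‖vᵢ‖ ≥ L} ≤ q⁻¹ L⁻² Σᵢ ‖vᵢ(s)‖²` (`fast_count_le_energy_div`), and the kinetic
energy is conserved along the flow with `E_λ Σ‖vᵢ(0)‖² = (N+1)∫ρ₀(3θ₀+|u₀|²)(1+o(1)) < ∞`. So
crowded cells hold FEW PARTICLES for free; what they may still hold is ENERGY (the residual R of
the card). Kept under its planning name for the card's references. -/
def CrowdedCellsExtensive : Prop :=
  ∀ (a₀ θ₀ : T3 → ℝ) (u₀ : T3 → V3), Continuous a₀ → Continuous θ₀ → Continuous u₀ →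
    (∀ x, 0 < a₀ x) → (∀ x, 0 < θ₀ x) → ∃ σ₀ : ℝ, 0 < σ₀ ∧ ∀ σ : ℝ, 0 < σ → σ < σ₀ →
    ∀ (T : ℝ) (ρ θ : ℝ → T3 → ℝ) (u : ℝ → T3 → V3), IsHardSphereEulerSolution σ T ρ u θ →
    ∀ Φ : (N : ℕ) → HardSphereFlow (Torus.geometry (Fin 3)) (hsDiameter σ N) (N + 1),
    TendstoHydroFieldsAt (fun N => localGibbsLaw σ a₀ u₀ θ₀ N (Φ N)) Φ ρ u θ 0 →
    ∀ t ∈ Set.Ico 0 T, ∀ r : ℝ, 0 < r → ∀ q : ℝ, 0 < q → q < 1 →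
    ∃ C : ℝ, ∀ L : ℝ, 0 < L → ∃ N₀ : ℕ, ∀ N : ℕ, N₀ ≤ N → ∀ s ∈ Set.Icc 0 t,
      let cell : T3 → (Fin 3 → ℤ) := Torus.coarseCell (r * ((N + 1 : ℕ) : ℝ) ^ (-(1 / 3 : ℝ)))
      ∫⁻ z, ENNReal.ofReal (((N : ℝ) + 1)⁻¹ *
          ((Finset.univ.filter fun i : Fin (N + 1) =>
            let Z := (Φ N).flow s z
            let mates := Finset.univ.filter fun j : Fin (N + 1) => cell (Z j).1 = cell (Z i).1
            q * (mates.card : ℝ) ≤ ((mates.filter fun j => L ≤ ‖(Z j).2‖).card : ℝ)).card : ℝ))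
        ∂(localGibbsLaw σ a₀ u₀ θ₀ N (Φ N)) ≤ ENNReal.ofReal (C / (q * L ^ 2))

end Summit.AtomisticToContinuum.HydrodynamicLimit.Cruxes.EnergyCurrentTails.IdeatorTwo

end
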